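import Mathlib
import HarnessLib
import Summits.CriticalPhenomena.PercolationContinuityZ3.Theses.PercTreeValue
import Summits.CriticalPhenomena.PercolationContinuityZ3.Theses.PercAnnulusCrossing
import Summits.CriticalPhenomena.PercolationContinuityZ3.Theorems.PercTreeValueAssembly
import Summits.CriticalPhenomena.PercolationContinuityZ3.Theorems.PercTreeValueConnectionPatternFactorisation
import Summits.CriticalPhenomena.PercolationContinuityZ3.Theorems.PercTreeValueTetrahedronHarrisGapCollarReduction

/-!
# Route PercTreeValue — the rev-7 composition of line `SketchIdeator1` for the crux `TetrahedronHarrisGap`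
# (stmt-CriticalPhenomena-7799), concluded BY NAME: X_B ∧ box restriction ∧ restricted gluing ⇒ `TetrahedronHarrisGap`

Lead prover-line-stmt-CriticalPhenomena-7799-c3-0 (continuation c3).  Companion of
`PercTreeValueTetrahedronHarrisGapCollarReduction.lean` (`stub_cruxOfCollar`: the crux FORMULA from the three inputs).  Here:

* `stub_cruxOfCollarByName` (registered transfer of skeleton rev 7): the sibling route's crux
  `PercAnnulusCrossing.CritAnnulusNonCrossing` (stmt-CriticalPhenomena-0846, BY NAME), the registered open stub `stub_boxRestriction`
  of the sibling crux stmt-CriticalPhenomena-7798 (verbatim: `0 ↔ a_r` inside `[−r,2r]² × [−2r, 3⌊r/8⌋]` at rate `≥ c τ(0,a_r)`) and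
  this line's `stub_restrictedGluing` (`P(0 ↔ b_r | 0 ↔ a_r in the box, b_r ↔ c_r in {x₂ ≥ r − 3⌊r/8⌋}) ≥ c_g`) imply
  `PercTreeValue.TetrahedronHarrisGap` (stmt-CriticalPhenomena-7799) by name;
* `tetrahedronHarrisGap_of_annulusNonCrossing_of_boxRestriction_of_restrictedGluing` — the same under a descriptive name;
* `percolationContinuityZ3_of_annulusNonCrossing_of_boxRestriction_of_restrictedGluing` — composed with the landed
  `percTreeValue_assembly_proof` and `connectionPatternFactorisation_proof`: the triple settles `θ(p_c(ℤ³)) = 0`.  (X_B alone already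
  does, through route `PercAnnulusCrossing`; the two other inputs hold in a jump world — they are the world-neutral part of the
  rev-7 open content.)
-/

noncomputable section

namespace Summit.CriticalPhenomena.PercolationContinuityZ3.Theorems.TetrahedronHarrisGap

open MeasureTheory
open Literature.Probability.Percolation Literature.Probability.LatticeModels

/-- **`stub_cruxOfCollarByName`** (registered transfer stub of skeleton rev 7, line `SketchIdeator1`): X_B
(`PercAnnulusCrossing.CritAnnulusNonCrossing`, stmt-0846, BY NAME) ∧ BOX RESTRICTION (7798's registered open stub S5', verbatim) ∧
RESTRICTED GLUING ⟹ `PercTreeValue.TetrahedronHarrisGap` (stmt-7799) by name — unfold both names and apply `stub_cruxOfCollar`. -/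
theorem stub_cruxOfCollarByName
    (hXB : Summit.CriticalPhenomena.PercolationContinuityZ3.Theses.PercAnnulusCrossing.CritAnnulusNonCrossing)
    (hBox : ∃ c : ℝ, 0 < c ∧ ∃ r₀ : ℕ, ∀ r : ℕ, r₀ ≤ r →
      c * tau 3 (criticalProbI 3) 0 ![(r : ℤ), (r : ℤ), 0] ≤
        (bondPercolation (zdGraph 3) (criticalProbI 3)).real
          (openConnIn
            {x : Site 3 | -(r : ℤ) ≤ x 0 ∧ x 0 ≤ 2 * (r : ℤ) ∧ -(r : ℤ) ≤ x 1 ∧ x 1 ≤ 2 * (r : ℤ) ∧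
              -(2 * (r : ℤ)) ≤ x 2 ∧ x 2 ≤ 3 * ((r : ℤ) / 8)}
            (0 : Site 3) ![(r : ℤ), (r : ℤ), 0]))
    (hGlue : ∃ c : ℝ, 0 < c ∧ ∃ r₀ : ℕ, ∀ r : ℕ, r₀ ≤ r →
      c * (bondPercolation (zdGraph 3) (criticalProbI 3)).real
          (openConnIn
              {x : Site 3 | -(r : ℤ) ≤ x 0 ∧ x 0 ≤ 2 * (r : ℤ) ∧ -(r : ℤ) ≤ x 1 ∧ x 1 ≤ 2 * (r : ℤ) ∧
                -(2 * (r : ℤ)) ≤ x 2 ∧ x 2 ≤ 3 * ((r : ℤ) / 8)}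
              (0 : Site 3) ![(r : ℤ), (r : ℤ), 0] ∩
            openConnIn {x : Site 3 | (r : ℤ) - 3 * ((r : ℤ) / 8) ≤ x 2}
              (![(r : ℤ), 0, (r : ℤ)] : Site 3) ![0, (r : ℤ), (r : ℤ)]) ≤
        (bondPercolation (zdGraph 3) (criticalProbI 3)).real
          (openConnIn
              {x : Site 3 | -(r : ℤ) ≤ x 0 ∧ x 0 ≤ 2 * (r : ℤ) ∧ -(r : ℤ) ≤ x 1 ∧ x 1 ≤ 2 * (r : ℤ) ∧
                -(2 * (r : ℤ)) ≤ x 2 ∧ x 2 ≤ 3 * ((r : ℤ) / 8)}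
              (0 : Site 3) ![(r : ℤ), (r : ℤ), 0] ∩
            openConnIn {x : Site 3 | (r : ℤ) - 3 * ((r : ℤ) / 8) ≤ x 2}
              (![(r : ℤ), 0, (r : ℤ)] : Site 3) ![0, (r : ℤ), (r : ℤ)] ∩
            openConn (0 : Site 3) ![(r : ℤ), 0, (r : ℤ)])) :
    Summit.CriticalPhenomena.PercolationContinuityZ3.Theses.PercTreeValue.TetrahedronHarrisGap := by
  unfold Summit.CriticalPhenomena.PercolationContinuityZ3.Theses.PercAnnulusCrossing.CritAnnulusNonCrossing at hXB
  unfold Summit.CriticalPhenomena.PercolationContinuityZ3.Theses.PercTreeValue.TetrahedronHarrisGap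
  exact stub_cruxOfCollar hXB hBox hGlue

/-- **X_B ∧ box restriction ∧ restricted gluing ⇒ `TetrahedronHarrisGap`** (descriptive alias of `stub_cruxOfCollarByName`). -/
theorem tetrahedronHarrisGap_of_annulusNonCrossing_of_boxRestriction_of_restrictedGluing
    (hXB : Theses.PercAnnulusCrossing.CritAnnulusNonCrossing)
    (hBox : ∃ c : ℝ, 0 < c ∧ ∃ r₀ : ℕ, ∀ r : ℕ, r₀ ≤ r →
      c * tau 3 (criticalProbI 3) 0 ![(r : ℤ), (r : ℤ), 0] ≤
        (bondPercolation (zdGraph 3) (criticalProbI 3)).real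
          (openConnIn
            {x : Site 3 | -(r : ℤ) ≤ x 0 ∧ x 0 ≤ 2 * (r : ℤ) ∧ -(r : ℤ) ≤ x 1 ∧ x 1 ≤ 2 * (r : ℤ) ∧
              -(2 * (r : ℤ)) ≤ x 2 ∧ x 2 ≤ 3 * ((r : ℤ) / 8)}
            (0 : Site 3) ![(r : ℤ), (r : ℤ), 0]))
    (hGlue : ∃ c : ℝ, 0 < c ∧ ∃ r₀ : ℕ, ∀ r : ℕ, r₀ ≤ r →
      c * (bondPercolation (zdGraph 3) (criticalProbI 3)).real
          (openConnIn
              {x : Site 3 | -(r : ℤ) ≤ x 0 ∧ x 0 ≤ 2 * (r : ℤ) ∧ -(r : ℤ) ≤ x 1 ∧ x 1 ≤ 2 * (r : ℤ) ∧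
                -(2 * (r : ℤ)) ≤ x 2 ∧ x 2 ≤ 3 * ((r : ℤ) / 8)}
              (0 : Site 3) ![(r : ℤ), (r : ℤ), 0] ∩
            openConnIn {x : Site 3 | (r : ℤ) - 3 * ((r : ℤ) / 8) ≤ x 2}
              (![(r : ℤ), 0, (r : ℤ)] : Site 3) ![0, (r : ℤ), (r : ℤ)]) ≤
        (bondPercolation (zdGraph 3) (criticalProbI 3)).real
          (openConnIn
              {x : Site 3 | -(r : ℤ) ≤ x 0 ∧ x 0 ≤ 2 * (r : ℤ) ∧ -(r : ℤ) ≤ x 1 ∧ x 1 ≤ 2 * (r : ℤ) ∧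
                -(2 * (r : ℤ)) ≤ x 2 ∧ x 2 ≤ 3 * ((r : ℤ) / 8)}
              (0 : Site 3) ![(r : ℤ), (r : ℤ), 0] ∩
            openConnIn {x : Site 3 | (r : ℤ) - 3 * ((r : ℤ) / 8) ≤ x 2}
              (![(r : ℤ), 0, (r : ℤ)] : Site 3) ![0, (r : ℤ), (r : ℤ)] ∩
            openConn (0 : Site 3) ![(r : ℤ), 0, (r : ℤ)])) :
    Theses.PercTreeValue.TetrahedronHarrisGap :=
  stub_cruxOfCollarByName hXB hBox hGlue

/-- X_B together with box restriction and restricted gluing settles the conjunct `θ(p_c(ℤ³)) = 0` (through the landed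
`percTreeValue_assembly_proof` and `connectionPatternFactorisation_proof`).  Formal record that the rev-7 open content of line
`SketchIdeator1` is continuity-strength (necessarily: the crux implies the conjunct); its continuity content sits in X_B. -/
theorem percolationContinuityZ3_of_annulusNonCrossing_of_boxRestriction_of_restrictedGluing
    (hXB : Theses.PercAnnulusCrossing.CritAnnulusNonCrossing)
    (hBox : ∃ c : ℝ, 0 < c ∧ ∃ r₀ : ℕ, ∀ r : ℕ, r₀ ≤ r →
      c * tau 3 (criticalProbI 3) 0 ![(r : ℤ), (r : ℤ), 0] ≤
        (bondPercolation (zdGraph 3) (criticalProbI 3)).real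
          (openConnIn
            {x : Site 3 | -(r : ℤ) ≤ x 0 ∧ x 0 ≤ 2 * (r : ℤ) ∧ -(r : ℤ) ≤ x 1 ∧ x 1 ≤ 2 * (r : ℤ) ∧
              -(2 * (r : ℤ)) ≤ x 2 ∧ x 2 ≤ 3 * ((r : ℤ) / 8)}
            (0 : Site 3) ![(r : ℤ), (r : ℤ), 0]))
    (hGlue : ∃ c : ℝ, 0 < c ∧ ∃ r₀ : ℕ, ∀ r : ℕ, r₀ ≤ r →
      c * (bondPercolation (zdGraph 3) (criticalProbI 3)).real
          (openConnIn
              {x : Site 3 | -(r : ℤ) ≤ x 0 ∧ x 0 ≤ 2 * (r : ℤ) ∧ -(r : ℤ) ≤ x 1 ∧ x 1 ≤ 2 * (r : ℤ) ∧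
                -(2 * (r : ℤ)) ≤ x 2 ∧ x 2 ≤ 3 * ((r : ℤ) / 8)}
              (0 : Site 3) ![(r : ℤ), (r : ℤ), 0] ∩
            openConnIn {x : Site 3 | (r : ℤ) - 3 * ((r : ℤ) / 8) ≤ x 2}
              (![(r : ℤ), 0, (r : ℤ)] : Site 3) ![0, (r : ℤ), (r : ℤ)]) ≤
        (bondPercolation (zdGraph 3) (criticalProbI 3)).real
          (openConnIn
              {x : Site 3 | -(r : ℤ) ≤ x 0 ∧ x 0 ≤ 2 * (r : ℤ) ∧ -(r : ℤ) ≤ x 1 ∧ x 1 ≤ 2 * (r : ℤ) ∧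
                -(2 * (r : ℤ)) ≤ x 2 ∧ x 2 ≤ 3 * ((r : ℤ) / 8)}
              (0 : Site 3) ![(r : ℤ), (r : ℤ), 0] ∩
            openConnIn {x : Site 3 | (r : ℤ) - 3 * ((r : ℤ) / 8) ≤ x 2}
              (![(r : ℤ), 0, (r : ℤ)] : Site 3) ![0, (r : ℤ), (r : ℤ)] ∩
            openConn (0 : Site 3) ![(r : ℤ), 0, (r : ℤ)])) :
    _root_.PercolationContinuityZ3 := by
  have hA := percTreeValue_assembly_proof
  unfold Theses.PercTreeValue.Assembly at hA
  exact hA connectionPatternFactorisation_proof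
    (tetrahedronHarrisGap_of_annulusNonCrossing_of_boxRestriction_of_restrictedGluing hXB hBox hGlue)

end Summit.CriticalPhenomena.PercolationContinuityZ3.Theorems.TetrahedronHarrisGap

end
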